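import Summits.ResolutionOfSingularities.ResolutionOfSingularities.Theorems.PinchTowerTau

/-!
# PinchTower (P3/8) — the NON-POWER CONDITION `¬ IsConePower`: transport, the two polynomial identities that force a
cone power, the generic point (normality of the DVR `𝒪_{y₀}/𝔓`), and the exceptional fibre `κ(x)[X]`

Node «PinchTower» of `decomp-res-lens-2` (g31), see `Theorems/MaxContactCutPinchTower.lean`.

* §C1 `isConePower_map` / `isConePower_of_inv` — `IsConePower` along ring maps and under `a ↦ a⁻¹`;
* §C2 `isConePower_of_one_add_eq` — in `κ[T]`, `1 + λ Tⁿ = c·(α + β T)ⁿ` (`λ ≠ 0`, `n ≥ 1`) forces `IsConePower κ n λ`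
  (the `τ = 1` alternative at the non-power point (E34));
* §C3 `isConePower_of_mul_mem_pow` — `𝔫 ⊂ κ[X]` prime, `s ∉ 𝔫`, `s·(Xⁿ + λ) ∈ 𝔫ⁿ` forces `IsConePower κ n λ` (`𝔫 = (π)`,
  `πⁿ ∣ Xⁿ + λ`, so `π` is linear and `Xⁿ + λ = (X + ρ)ⁿ`), and its reflection `s·(λ Xⁿ + 1) ∈ 𝔫ⁿ`: the points of the
  exceptional fibre over a `k = 0` point have order `< n`;
* §C4 `not_isConePower_frac` — over the fraction field `K` of a Noetherian local domain `D` with principal maximal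
  ideal `(w)`: `λ wᵏ` (`λ` a unit) is NOT a cone `n`-th power in `K` if `0 < k < n`, or if `k ∈ {0, n}` and `λ̄` is not
  one in the residue field of `D` (`D` is integrally closed, [Matsumura1987] Thm. 11.2) — the condition at `η`;
* §C5 `exists_mul_mem_pow_fibre` — abstract fibre law: `S = B_𝔴`, `Φ : B → P` with `Φ⁻¹ 𝔫 = 𝔴`, `Φ t = 0`, and
  `F' = b₀ + t·r ∈ 𝔪_Sⁿ` ⇒ `s·Φ b₀ ∈ 𝔫ⁿ` for some `s ∉ 𝔫`; `exists_fibreMap` — for the Rees chart of a quasi-regular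
  pair `(z, u) ⊆ 𝔪_A` the map `Φ : B → κ(A)[X]`, `φ a ↦ ā`, `e ↦ X`, with `ker Φ ⊆ (t) + 𝔪_A B`
  ([StacksProject, Tag 0BIQ] via `chartQuotEquiv`).
-/

open IsLocalRing Polynomial
open Literature.AlgebraicGeometry.Resolution
open Summit.ResolutionOfSingularities.ResolutionOfSingularities.Theorems.PinchCut (IsConePower)

namespace Summit.ResolutionOfSingularities.ResolutionOfSingularities.Theorems.PinchTower

/-! ## §C1  Transport of `IsConePower` -/

/-- `IsConePower` is preserved by ring maps. [folklore] -/
theorem isConePower_map {κ L : Type} [CommRing κ] [CommRing L] (f : κ →+* L) {n : ℕ} {a : κ}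
    (h : IsConePower κ n a) : IsConePower L n (f a) := by
  obtain ⟨α, hα, hbin⟩ := h
  exact ⟨f α, by rw [← map_pow, hα], fun i hi hin => by rw [← map_natCast f, hbin i hi hin, map_zero]⟩

/-- Over a field, `a⁻¹` a cone power ⇒ `a` a cone power. [folklore] -/
theorem isConePower_of_inv {κ : Type} [Field κ] {n : ℕ} {a : κ} (h : IsConePower κ n a⁻¹) :
    IsConePower κ n a := by
  obtain ⟨α, hα, hbin⟩ := h
  exact ⟨α⁻¹, by rw [inv_pow, hα, inv_inv], hbin⟩

/-! ## §C2  `1 + λ Tⁿ = c (α + β T)ⁿ` forces a cone power -/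

/-- **Field lemma (E34, `τ = 1`)**: in `κ[T]` over a field, `1 + λ Tⁿ = c·(α + β T)ⁿ` with `λ ≠ 0`, `n ≥ 1` forces
`IsConePower κ n λ`: `β ≠ 0`, write `α + βT = β (T + γ)`; comparing coefficients, `1 = cβⁿγⁿ`, `λ = cβⁿ`, and
`cβⁿ γⁿ⁻ⁱ C(n, i) = 0` for `0 < i < n`; so `λ = (γ⁻¹)ⁿ` and the `C(n, i)` vanish in `κ`. [folklore] -/
theorem isConePower_of_one_add_eq {κ : Type} [Field κ] {n : ℕ} (hn : 1 ≤ n) {lam c α β : κ} (hlam : lam ≠ 0)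
    (h : (1 + C lam * X ^ n : κ[X]) = C c * (C α + C β * X) ^ n) : IsConePower κ n lam := by
  classical
  have hn0 : n ≠ 0 := by omega
  -- coefficients of the left side
  have hL : ∀ k, (1 + C lam * X ^ n : κ[X]).coeff k = (if k = 0 then 1 else 0) + (if k = n then lam else 0) := by
    intro k
    rw [coeff_add, coeff_one, coeff_C_mul, coeff_X_pow]
    split_ifs <;> simp
  have hβ : β ≠ 0 := by
    rintro rfl
    have h1 := congrArg (fun p : κ[X] => p.coeff n) h
    simp only [hL, zero_add, map_zero, zero_mul, add_zero, ← C_pow, ← C_mul, coeff_C, if_neg hn0] at h1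
    exact hlam h1
  set γ := α / β with hγ
  have hlin : (C α + C β * X : κ[X]) = C β * (X + C γ) := by
    have e : β * γ = α := by rw [hγ]; field_simp
    rw [mul_add, ← C_mul, e, add_comm]
  rw [hlin, mul_pow, ← mul_assoc, ← C_pow, ← C_mul] at h
  -- compare coefficients
  have hk : ∀ k, ((if k = 0 then 1 else 0) + (if k = n then lam else 0) : κ) =
      c * β ^ n * (γ ^ (n - k) * (n.choose k : κ)) := by
    intro k
    have h1 := congrArg (fun p : κ[X] => p.coeff k) h
    simp only [hL, coeff_C_mul, coeff_X_add_C_pow] at h1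
    exact h1
  have h0 := hk 0
  rw [if_pos rfl, if_neg (Ne.symm hn0), add_zero, Nat.sub_zero, Nat.choose_zero_right, Nat.cast_one,
    mul_one] at h0
  have hnn := hk n
  rw [if_neg hn0, if_pos rfl, zero_add, Nat.sub_self, pow_zero, Nat.choose_self, Nat.cast_one, mul_one,
    mul_one] at hnn
  -- `1 = λ γⁿ`
  have hγn : lam * γ ^ n = 1 := by rw [hnn]; exact h0.symm
  have hγ0 : γ ≠ 0 := by
    rintro hz
    rw [hz, zero_pow hn0, mul_zero] at hγn
    exact zero_ne_one hγn
  refine ⟨γ⁻¹, ?_, fun i hi hin => ?_⟩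
  · rw [inv_pow]
    exact (eq_inv_of_mul_eq_one_left hγn).symm
  · have hi' := hk i
    rw [if_neg (by omega), if_neg (by omega), add_zero, ← hnn] at hi'
    have : lam * γ ^ (n - i) * (n.choose i : κ) = 0 := by rw [mul_assoc]; exact hi'.symm
    rcases mul_eq_zero.mp this with h2 | h2
    · rcases mul_eq_zero.mp h2 with h3 | h3
      · exact absurd h3 hlam
      · exact absurd h3 (pow_ne_zero _ hγ0)
    · exact h2

/-! ## §C3  `s·(Xⁿ + λ) ∈ 𝔫ⁿ` with `s ∉ 𝔫` forces a cone power -/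

/-- **Fibre lemma (`k = 0`)**: `κ` a field, `𝔫 ⊂ κ[X]` a prime ideal, `s ∉ 𝔫`, `s·(Xⁿ + λ) ∈ 𝔫ⁿ`, `λ ≠ 0`, `n ≥ 1`
⇒ `IsConePower κ n λ`.  `𝔫 ≠ 0` is generated by a prime `π` with `πⁿ ∣ Xⁿ + λ`, so `deg π = 1`, `π ~ X + ρ`, and
`Xⁿ + λ = (X + ρ)ⁿ`: `λ = ρⁿ` and `ρⁿ⁻ⁱ C(n,i) = 0` for `0 < i < n`. [folklore] -/
theorem isConePower_of_mul_mem_pow {κ : Type} [Field κ] {n : ℕ} (hn : 1 ≤ n) {lam : κ} (hlam : lam ≠ 0)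
    (𝔫 : Ideal κ[X]) [h𝔫 : 𝔫.IsPrime] {s : κ[X]} (hs : s ∉ 𝔫) (h : s * (X ^ n + C lam) ∈ 𝔫 ^ n) :
    IsConePower κ n lam := by
  classical
  have hn0 : n ≠ 0 := by omega
  set P : κ[X] := X ^ n + C lam with hP
  have hPmonic : P.Monic := monic_X_pow_add_C lam hn0
  have hPdeg : P.natDegree = n := natDegree_X_pow_add_C
  have hP0 : P ≠ 0 := hPmonic.ne_zero
  have hbot : 𝔫 ≠ ⊥ := by
    intro hb
    rw [hb, ← Ideal.zero_eq_bot, zero_pow hn0, Ideal.zero_eq_bot, Ideal.mem_bot, mul_eq_zero] at h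
    rcases h with h | h
    · exact hs (by rw [hb, h]; exact Ideal.zero_mem _)
    · exact hP0 h
  -- a prime generator `π` of `𝔫`, `πⁿ ∣ P`
  set π := Submodule.IsPrincipal.generator 𝔫 with hπ
  have hspan : Ideal.span {π} = 𝔫 := Ideal.span_singleton_generator 𝔫
  have hprime : Prime π := Submodule.IsPrincipal.prime_generator_of_isPrime 𝔫 hbot
  have hdvd : π ^ n ∣ P := by
    have h' : s * P ∈ Ideal.span {π ^ n} := by rw [← Ideal.span_singleton_pow, hspan]; exact h
    have hns : ¬ π ∣ s := fun hd => hs (hspan ▸ Ideal.mem_span_singleton.mpr hd)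
    exact hprime.pow_dvd_of_dvd_mul_left n hns (Ideal.mem_span_singleton.mp h')
  -- `π` is linear
  have hπdeg : π.natDegree = 1 := by
    have h1 : 0 < π.natDegree := natDegree_pos_of_not_isUnit_of_dvd_monic hPmonic hprime.not_unit
      (dvd_trans (dvd_pow_self π hn0) hdvd)
    have h2 : (π ^ n).natDegree ≤ P.natDegree := natDegree_le_of_dvd hdvd hP0
    rw [natDegree_pow, hPdeg] at h2
    have h3 : π.natDegree ≤ 1 := by
      by_contra hc
      have : n * 2 ≤ n * π.natDegree := Nat.mul_le_mul_left n (by omega)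
      omega
    omega
  obtain ⟨b, e, hbe⟩ := exists_eq_X_add_C_of_natDegree_le_one hπdeg.le
  have hb : b ≠ 0 := by
    rintro rfl
    rw [hbe, map_zero, zero_mul, zero_add, natDegree_C] at hπdeg
    exact zero_ne_one hπdeg
  set ρ := e / b with hρ
  have hlin : (X + C ρ) ∣ π := ⟨C b, by
    have e1 : ρ * b = e := by rw [hρ]; field_simp
    rw [hbe, add_mul, ← C_mul, e1, mul_comm X (C b)]⟩
  set Q : κ[X] := (X + C ρ) ^ n with hQ
  have hQmonic : Q.Monic := (monic_X_add_C ρ).pow n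
  have hQdeg : Q.natDegree = n := by rw [hQ, (monic_X_add_C ρ).natDegree_pow, natDegree_X_add_C, mul_one]
  have hQP : Q ∣ P := dvd_trans (pow_dvd_pow_of_dvd hlin n) hdvd
  have hPQ : P = Q := eq_of_monic_of_dvd_of_natDegree_le hQmonic hPmonic hQP (by rw [hPdeg, hQdeg])
  -- compare coefficients of `Xⁿ + λ = (X + ρ)ⁿ`
  have hk : ∀ k, ((if k = n then 1 else 0) + (if k = 0 then lam else 0) : κ) = ρ ^ (n - k) * (n.choose k : κ) := by
    intro k
    have h1 := congrArg (fun p : κ[X] => p.coeff k) hPQ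
    simp only [hP, hQ, coeff_add, coeff_X_pow, coeff_C, coeff_X_add_C_pow] at h1
    convert h1 using 2
  have h0 := hk 0
  rw [if_neg (Ne.symm hn0), if_pos rfl, zero_add, Nat.sub_zero, Nat.choose_zero_right, Nat.cast_one,
    mul_one] at h0
  have hρ0 : ρ ≠ 0 := by
    rintro hz
    rw [hz, zero_pow hn0] at h0
    exact hlam h0
  refine ⟨ρ, h0.symm, fun i hi hin => ?_⟩
  have hi' := hk i
  rw [if_neg (by omega), if_neg (by omega), add_zero] at hi'
  rcases mul_eq_zero.mp hi'.symm with h2 | h2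
  · exact absurd h2 (pow_ne_zero _ hρ0)
  · exact h2

/-- **Reflected fibre lemma**: `s·(λ Xⁿ + 1) ∈ 𝔫ⁿ` with `s ∉ 𝔫` (`λ ≠ 0`, `n ≥ 1`) forces `IsConePower κ n λ`
(`λ Xⁿ + 1 = λ·(Xⁿ + λ⁻¹)`). [folklore] -/
theorem isConePower_of_mul_mem_pow' {κ : Type} [Field κ] {n : ℕ} (hn : 1 ≤ n) {lam : κ} (hlam : lam ≠ 0)
    (𝔫 : Ideal κ[X]) [h𝔫 : 𝔫.IsPrime] {s : κ[X]} (hs : s ∉ 𝔫) (h : s * (C lam * X ^ n + 1) ∈ 𝔫 ^ n) :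
    IsConePower κ n lam := by
  have heq : (C lam * X ^ n + 1 : κ[X]) = C lam * (X ^ n + C lam⁻¹) := by
    rw [mul_add, ← C_mul, mul_inv_cancel₀ hlam, C_1]
  rw [heq, ← mul_assoc] at h
  have hs' : s * C lam ∉ 𝔫 := fun hmem => by
    rcases h𝔫.mem_or_mem hmem with h1 | h1
    · exact hs h1
    · exact h𝔫.ne_top (Ideal.eq_top_of_isUnit_mem _ h1 (isUnit_C.mpr (Ne.isUnit hlam)))
  exact isConePower_of_inv (isConePower_of_mul_mem_pow hn (inv_ne_zero hlam) 𝔫 hs' h)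

/-! ## §C4  The generic point: `λ wᵏ` is not a cone power in `Frac(D)` -/

/-- **The non-power condition at the generic point** [KERNEL]: `D` a Noetherian local domain whose maximal ideal is
principal `(w)`, `w ≠ 0` (so `D` is integrally closed), `K = Frac D`, `λ ∈ Dˣ`, `n ≥ 1`.  If `0 < k < n`, or if
`k ∈ {0, n}` and `λ̄` is not a cone `n`-th power in the residue field of `D`, then `λ wᵏ` is not a cone `n`-th power in
`K`: a root `α ∈ K` of `Xⁿ − λwᵏ` is integral, hence `α ∈ D`; `αⁿ = λ wᵏ` with `0 < k < n` is impossible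
(`α ∈ (w)` and cancelling `wᵏ` puts `λ` in `(w)`), and for `k ∈ {0, n}` it makes `λ̄` a cone power (the
`C(n, i)` vanish in `D` as they do in `K`). [cite: Matsumura1987, Thm. 11.2] -/
theorem not_isConePower_frac {D K : Type} [CommRing D] [IsDomain D] [IsNoetherianRing D] [IsLocalRing D]
    [Field K] [Algebra D K] [IsFractionRing D K] {w l : D} (hw : maximalIdeal D = Ideal.span {w})
    (hw0 : w ≠ 0) (hl : IsUnit l) {n k : ℕ} (hn : 1 ≤ n)
    (hc : (0 < k ∧ k < n) ∨ ((k = 0 ∨ k = n) ∧ ¬ IsConePower (ResidueField D) n (residue D l))) :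
    ¬ IsConePower K n (algebraMap D K (l * w ^ k)) := by
  classical
  rintro ⟨α, hα, hbin⟩
  have hn0 : n ≠ 0 := by omega
  -- `D` is integrally closed
  have htf := tfae_of_isNoetherianRing_of_isLocalRing_of_isDomain (R := D)
  have h43 : (maximalIdeal D).IsPrincipal ↔
      (IsIntegrallyClosed D ∧ ∀ P : Ideal D, P ≠ ⊥ → P.IsPrime → P = maximalIdeal D) := htf.out 4 3
  haveI : IsIntegrallyClosed D := (h43.mp ⟨⟨w, hw⟩⟩).1
  have hinj : Function.Injective (algebraMap D K) := IsFractionRing.injective D K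
  -- the binomial coefficients vanish in `D`
  have hbinD : ∀ i : ℕ, 0 < i → i < n → ((n.choose i : ℕ) : D) = 0 := fun i hi hin =>
    hinj (by rw [map_natCast, map_zero]; exact hbin i hi hin)
  -- roots descend to `D`
  have descend : ∀ (γ : K) (d : D), γ ^ n = algebraMap D K d → ∃ β : D, β ^ n = d := by
    intro γ d hγ
    have hint : IsIntegral D γ :=
      ⟨X ^ n - C d, monic_X_pow_sub_C d hn0, by simp [hγ]⟩
    obtain ⟨β, hβ⟩ := IsIntegrallyClosed.isIntegral_iff.mp hint
    exact ⟨β, hinj (by rw [map_pow, hβ, hγ])⟩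
  have cone_of_root : ∀ β : D, β ^ n = l → IsConePower (ResidueField D) n (residue D l) := fun β hβ =>
    ⟨residue D β, by rw [← map_pow, hβ], fun i hi hin => by
      rw [← map_natCast (residue D), hbinD i hi hin, map_zero]⟩
  have hwK : algebraMap D K w ≠ 0 := fun h0 => hw0 (hinj (by rw [h0, map_zero]))
  rcases hc with ⟨hk0, hkn⟩ | ⟨hk, hncone⟩
  · -- `0 < k < n`
    obtain ⟨β, hβ⟩ := descend α _ hα
    have hβm : β ∈ maximalIdeal D := by
      have h1 : β ^ n ∈ maximalIdeal D := by
        rw [hβ, hw]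
        obtain ⟨k', rfl⟩ : ∃ k', k = k' + 1 := ⟨k - 1, by omega⟩
        rw [pow_succ, ← mul_assoc]
        exact Ideal.mul_mem_left _ _ (Ideal.mem_span_singleton_self w)
      exact (maximalIdeal.isMaximal D).isPrime.mem_of_pow_mem n h1
    rw [hw, Ideal.mem_span_singleton'] at hβm
    obtain ⟨β₁, rfl⟩ := hβm
    have h2 : w ^ k * (β₁ ^ n * w ^ (n - k) - l) = 0 := by
      have e : w ^ k * (β₁ ^ n * w ^ (n - k)) = (β₁ * w) ^ n := by
        rw [mul_pow, mul_comm, mul_assoc, ← pow_add, Nat.sub_add_cancel hkn.le]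
      rw [mul_sub, e, hβ]; ring
    rcases mul_eq_zero.mp h2 with h3 | h3
    · exact hw0 (pow_eq_zero_iff (by omega) |>.mp h3)
    · have hlm : l ∈ maximalIdeal D := by
        rw [(sub_eq_zero.mp h3).symm, hw]
        obtain ⟨j, hj⟩ : ∃ j, n - k = j + 1 := ⟨n - k - 1, by omega⟩
        rw [hj, pow_succ, ← mul_assoc]
        exact Ideal.mul_mem_left _ _ (Ideal.mem_span_singleton_self w)
      exact (IsLocalRing.notMem_maximalIdeal.mpr hl) hlm
  · rcases hk with rfl | hkn
    · rw [pow_zero, mul_one] at hα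
      obtain ⟨β, hβ⟩ := descend α l hα
      exact hncone (cone_of_root β hβ)
    · -- `k = n`: divide the root by `w`
      rw [hkn] at hα
      have hα' : (α / algebraMap D K w) ^ n = algebraMap D K l := by
        rw [div_pow, hα, map_mul, map_pow, mul_div_assoc, div_self (pow_ne_zero n hwK), mul_one]
      obtain ⟨β, hβ⟩ := descend _ l hα'
      exact hncone (cone_of_root β hβ)

/-! ## §C5  The exceptional fibre over a point: `S/𝔪_A S` is a local localisation of `κ(A)[X]` -/

/-- **Abstract fibre law**: `S = B_𝔴` local, `Φ : B → P` a ring map and `𝔫 ⊆ P` an ideal with `Φ⁻¹ 𝔫 = 𝔴`,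
`Φ t = 0`; if `F' = b₀ + t·r ∈ 𝔪_Sⁿ` then `s · Φ b₀ ∈ 𝔫ⁿ` for some `s ∉ 𝔫` (clear denominators in
`𝔪_Sⁿ = 𝔴ⁿ S`). [folklore] -/
theorem exists_mul_mem_pow_fibre {B S P : Type} [CommRing B] [CommRing S] [IsLocalRing S] [CommRing P]
    (𝔴 : Ideal B) [h𝔴 : 𝔴.IsPrime] [Algebra B S] [IsLocalization.AtPrime S 𝔴]
    (Φ : B →+* P) (𝔫 : Ideal P) (hΦ : ∀ b, b ∈ 𝔴 ↔ Φ b ∈ 𝔫) {t b₀ : B} (ht : Φ t = 0) {r F' : S} {n : ℕ}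
    (hFb : F' = algebraMap B S b₀ + algebraMap B S t * r) (hF : F' ∈ maximalIdeal S ^ n) :
    ∃ s ∉ 𝔫, s * Φ b₀ ∈ 𝔫 ^ n := by
  have hmS : maximalIdeal S ^ n = Ideal.map (algebraMap B S) (𝔴 ^ n) := by
    rw [Ideal.map_pow, IsLocalization.AtPrime.map_eq_maximalIdeal 𝔴 S]
  rw [hmS, IsLocalization.mem_map_algebraMap_iff 𝔴.primeCompl S] at hF
  obtain ⟨⟨⟨i, hi⟩, ⟨s₁, hs₁⟩⟩, h1⟩ := hF
  obtain ⟨⟨rB, ⟨s₂, hs₂⟩⟩, h2⟩ := IsLocalization.surj 𝔴.primeCompl r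
  simp only at h1 h2
  have h3 : algebraMap B S ((b₀ * s₂ + t * rB) * s₁) = algebraMap B S (i * s₂) := by
    simp only [map_mul, map_add]
    rw [← h1, ← h2, hFb]
    ring
  obtain ⟨⟨s₃, hs₃⟩, h4⟩ := (IsLocalization.eq_iff_exists 𝔴.primeCompl S).mp h3
  simp only at h4
  refine ⟨Φ (s₃ * s₂ * s₁), fun hmem => ?_, ?_⟩
  · have h5 := (hΦ _).mpr hmem
    rcases h𝔴.mem_or_mem h5 with h6 | h6
    · rcases h𝔴.mem_or_mem h6 with h7 | h7
      · exact hs₃ h7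
      · exact hs₂ h7
    · exact hs₁ h6
  · have h5 : Φ (s₃ * s₂ * s₁) * Φ b₀ = Φ (s₃ * (i * s₂)) := by
      rw [← h4]
      simp only [map_mul, map_add, ht, zero_mul, add_zero]
      ring
    rw [h5]
    have hle : Ideal.map Φ (𝔴 ^ n) ≤ 𝔫 ^ n := by
      rw [Ideal.map_pow]
      exact Ideal.pow_right_mono (Ideal.map_le_iff_le_comap.mpr fun b hb => (hΦ b).mp hb) n
    exact hle (Ideal.mem_map_of_mem Φ (Ideal.mul_mem_left _ _ (Ideal.mul_mem_right _ _ hi)))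

/-- **The fibre map of a Rees chart**: for a quasi-regular pair `c = (c₀, c₁) ⊆ 𝔪_A` and chart index `i`
(`i'` the other one) there is a SURJECTIVE ring map `Φ : B = A[c/cᵢ] → κ(A)[X]` with `Φ(φ a) = ā`, `Φ(e_{i'}) = X`
and `ker Φ ⊆ (φ cᵢ) + 𝔪_A·B` — the composite `B → B/(φ cᵢ) ≅ (A/(c))[X] → κ(A)[X]` (`chartQuotEquiv`).
[cite: StacksProject, Tag 0BIQ] -/
theorem exists_fibreMap {A : Type} [CommRing A] [IsLocalRing A] (c : Fin 2 → A) (hq : IsQuasiRegular c)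
    (hcm : ∀ j, c j ∈ maximalIdeal A) (i i' : Fin 2) (hi : i' ≠ i) :
    ∃ Φ : chartRing c i →+* (ResidueField A)[X], Function.Surjective Φ ∧
      (∀ a, Φ (chartBase c i a) = C (residue A a)) ∧ Φ (chartGen c i i') = X ∧
      ∀ b, Φ b = 0 → b ∈ Ideal.span {chartBase c i (c i)} ⊔ (maximalIdeal A).map (chartBase c i) := by
  classical
  have hI₀ : Ideal.span (Set.range c) ≤ maximalIdeal A :=
    Ideal.span_le.mpr (by rintro _ ⟨j, rfl⟩; exact hcm j)
  let θ : A ⧸ Ideal.span (Set.range c) →+* ResidueField A :=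
    Ideal.Quotient.lift _ (residue A) fun a ha => (IsLocalRing.residue_eq_zero_iff _).mpr (hI₀ ha)
  have hθ : ∀ a, θ (Ideal.Quotient.mk _ a) = residue A a := fun a => Ideal.Quotient.lift_mk _ _ _
  have hθsurj : Function.Surjective θ := fun x => by
    obtain ⟨a, rfl⟩ := IsLocalRing.residue_surjective x
    exact ⟨Ideal.Quotient.mk _ a, hθ a⟩
  letI : Unique {j : Fin 2 // j ≠ i} :=
    { default := ⟨i', hi⟩
      uniq := fun j => Subtype.ext (Fin.ext (by
        have h1 := Fin.val_ne_of_ne j.2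
        have h2 := Fin.val_ne_of_ne hi
        have := j.1.isLt
        have := i.isLt
        have := i'.isLt
        simp only
        omega)) }
  let e₀ : Polynomial (A ⧸ Ideal.span (Set.range c)) ≃+* chartRing c i ⧸ Ideal.span {chartBase c i (c i)} :=
    (MvPolynomial.uniqueAlgEquiv (A ⧸ Ideal.span (Set.range c)) {j : Fin 2 // j ≠ i}).symm.toRingEquiv.trans
      (chartQuotEquiv c i hq)
  have he₀C : ∀ a : A, e₀ (Polynomial.C (Ideal.Quotient.mk _ a)) = Ideal.Quotient.mk _ (chartBase c i a) := by
    intro a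
    show chartQuotEquiv c i hq ((MvPolynomial.uniqueAlgEquiv _ _).symm (Polynomial.C _)) = _
    rw [MvPolynomial.uniqueAlgEquiv_symm_apply, Polynomial.eval₂_C, chartQuotEquiv_apply, chartQuotMap_C]
  have he₀X : e₀ Polynomial.X = Ideal.Quotient.mk _ (chartGen c i i') := by
    show chartQuotEquiv c i hq ((MvPolynomial.uniqueAlgEquiv _ _).symm Polynomial.X) = _
    rw [MvPolynomial.uniqueAlgEquiv_symm_apply, Polynomial.eval₂_X, chartQuotEquiv_apply, chartQuotMap_X]
    rfl
  let Φ : chartRing c i →+* (ResidueField A)[X] :=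
    (Polynomial.mapRingHom θ).comp (e₀.symm.toRingHom.comp (Ideal.Quotient.mk _))
  have hΦ : ∀ b, Φ b = Polynomial.map θ (e₀.symm (Ideal.Quotient.mk _ b)) := fun b => rfl
  refine ⟨Φ, ?_, fun a => ?_, ?_, fun b hb => ?_⟩
  · exact (Polynomial.map_surjective θ hθsurj).comp
      (e₀.symm.surjective.comp Ideal.Quotient.mk_surjective)
  · rw [hΦ, show e₀.symm (Ideal.Quotient.mk _ (chartBase c i a)) = Polynomial.C (Ideal.Quotient.mk _ a) from
      (RingEquiv.symm_apply_eq e₀).mpr (he₀C a).symm, Polynomial.map_C, hθ]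
  · rw [hΦ, show e₀.symm (Ideal.Quotient.mk _ (chartGen c i i')) = Polynomial.X from
      (RingEquiv.symm_apply_eq e₀).mpr he₀X.symm, Polynomial.map_X]
  · set q := e₀.symm (Ideal.Quotient.mk _ b) with hqdef
    have hq0 : Polynomial.map θ q = 0 := by rw [← hΦ]; exact hb
    have hcoef : ∀ j, θ (q.coeff j) = 0 := fun j => by
      have := congrArg (fun p => Polynomial.coeff p j) hq0
      simpa only [Polynomial.coeff_map, Polynomial.coeff_zero] using this
    choose a ha using fun j => Ideal.Quotient.mk_surjective (I := Ideal.span (Set.range c)) (q.coeff j)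
    have ham : ∀ j, a j ∈ maximalIdeal A := fun j => by
      rw [← IsLocalRing.residue_eq_zero_iff, ← hθ, ha]; exact hcoef j
    have he₀q : e₀ q = Ideal.Quotient.mk _ (∑ j ∈ q.support, chartBase c i (a j) * chartGen c i i' ^ j) := by
      conv_lhs => rw [q.as_sum_support_C_mul_X_pow]
      rw [map_sum, map_sum]
      refine Finset.sum_congr rfl fun j _ => ?_
      rw [map_mul, map_pow, ← ha, he₀C, he₀X, ← map_pow, ← map_mul]
    have hb' : Ideal.Quotient.mk _ b = e₀ q := by rw [hqdef, RingEquiv.apply_symm_apply]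
    rw [he₀q, Ideal.Quotient.eq] at hb'
    have : b = (b - ∑ j ∈ q.support, chartBase c i (a j) * chartGen c i i' ^ j) +
        ∑ j ∈ q.support, chartBase c i (a j) * chartGen c i i' ^ j := by ring
    rw [this]
    exact Ideal.add_mem _ (Ideal.mem_sup_left hb')
      (Ideal.mem_sup_right (Ideal.sum_mem _ fun j _ => Ideal.mul_mem_right _ _ (Ideal.mem_map_of_mem _ (ham j))))

end Summit.ResolutionOfSingularities.ResolutionOfSingularities.Theorems.PinchTower
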